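import Summits.BirchSwinnertonDyer.BirchSwinnertonDyer.Theorems.ByReductionTypeAtTwoGoodOrdTowerControlLayerBound
import Literature.NumberTheory.EllipticCurves.IwasawaSelmerControlOfLayerKernelsProofs
import Literature.NumberTheory.EllipticCurves.IwasawaSelmerControlProofs
import HarnessLib

/-!
# Route `ByReductionTypeAtTwo`, item `OrdKatoHalfAtTwo` (stmt-BirchSwinnertonDyer-19271), TOWER road: MAZUR'S CONTROL
# THEOREM over `ℚ` at `p = 2` is a KERNEL THEOREM — `WeierstrassCurve.selmer_control` and Greenberg's Lemma 3.5
# `WeierstrassCurve.Greenberg1999_kerG_bounded` for every globally minimal `W/ℚ` and every `ℤ₂`-extension datum `κ`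

HONEST FRAMING (cell `bsd-2adic`, run/shared/lean/pub/bsd-2adic/, seat `bsd-2adic-tower-1` GEN 20, HUMAN RULINGS
D-0036 / D-0054 / D-0074): theorems only (no definition, no named fact, no `sorry`, axioms the standard trio); closes no
route item by itself; nothing booked; BSD is not proved by any of this. WHAT IT PROVES: the tree's named PREDICATES
`WeierstrassCurve.Greenberg1999_kerG_bounded κ` (Greenberg, LNM 1716, §3 Lemma 3.5: "The order of `ker(g_n)` is bounded as
`n` varies") and `WeierstrassCurve.selmer_control κ` (MAZUR'S CONTROL THEOREM, Greenberg Thm. 1.2 / Mazur 1972: for `E/ℚ`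
with good ordinary reduction at `2` and the cyclotomic `ℤ₂`-extension, the maps `Sel_{2^∞}(E/ℚ_n) → Sel_{2^∞}(E/ℚ_∞)^{Γ_n}`
have finite kernels and cokernels of order bounded independently of `n`) HOLD for every globally minimal `W/ℚ` and every
`κ : ZpExtension ℚ 2` — unconditionally (both predicates carry their own hypotheses `κ.IsCyclotomic`, good ordinary
reduction above `2`; for non-elliptic `W` or non-cyclotomic `κ` they are vacuous). The tree had reduced Lemma 3.5 to the
boundedness of the local tower kernels at `v ∣ p` (`Greenberg1999_kerG_bounded_of_atP_layerBounds`, cell bsd-cited-r05,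
p508219) — until now available only from the named PRINT fact `Greenberg1999.lemma34_natCard_localTowerKerPrimary_eq_rat`
(Lemma 3.4 at the layers; `…_of_lemma34`); `exists_natCard_localTowerKerPrimary_at_two_le`
(`…GoodOrdTowerControlLayerBound.lean`) proves that boundedness at `p = 2`, so at `p = 2` the print binder is gone.
The odd primes stay open here: the one `p = 2`-specific input is the Euler–Poincaré count of the formal-group torsion
`Ê[p^k]` over the layers, which at `p = 2` reduces by dévissage to the trivial module `𝔽₂` (every constituent has order `2`),
while for odd `p` it needs Tate's formula for the twisted line `𝔽_p(ωφ⁻¹)`, not in the tree.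

* `Greenberg1999_kerG_bounded_two` — `W.Greenberg1999_kerG_bounded κ` for `W/ℚ` globally minimal, `κ : ZpExtension ℚ 2`.
* `selmer_control_two` — **Mazur's control theorem `W.selmer_control κ` at `p = 2`**, same generality.
* `isTorsion_of_finite_selmerGroup_two` — Greenberg's Thm. 1.4 at `2` through the same chain (also available unconditionally
  at every `p` from the layer-`0` route, `SelmerDualData.isTorsion_of_finite_selmerGroup_rat`; recorded for the by-name chain).

References: B. Mazur, *Rational points of abelian varieties with values in towers of number fields*, Invent. Math. 18 (1972),
§6; R. Greenberg, *Iwasawa theory for elliptic curves*, LNM 1716 (1999), Thm. 1.2 (pp. 59–60), Thm. 1.4, §3 Lemmas 3.1–3.5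
(pp. 86–90); J. Milne, *ADT* (2006), I §2–3.
-/

set_option autoImplicit false
-- the Theorems namespace of this sub repeats the summit name by design (D-0017 nested layout: Summit.<S>.<Sub>)
set_option linter.dupNamespace false

noncomputable section

open scoped Classical

namespace Summit.BirchSwinnertonDyer.BirchSwinnertonDyer.Theorems.GoodOrdTower

open NumberField IsDedekindDomain Literature.NumberTheory.EllipticCurves
  Literature.NumberTheory.EllipticCurves.Rank1Residual WeierstrassCurve

/-- **Greenberg's Lemma 3.5 at `p = 2`, kernel-proved**: for `W/ℚ` globally minimal and any `κ : ZpExtension ℚ 2` the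
named predicate `W.Greenberg1999_kerG_bounded κ` holds — under its hypotheses (`W` elliptic, `κ` cyclotomic, good ordinary
reduction above `2`) the orders of `ker(g_n) = A_n / Sel_{2^∞}(E/ℚ_n)` are bounded in `n`. Proof: the tree's reduction
`Greenberg1999_kerG_bounded_of_atP_layerBounds` (Lemmas 3.3 at every layer and the finite decomposition, bsd-cited) fed with
`exists_natCard_localTowerKerPrimary_at_two_le` (Lemma 3.4's boundedness at the layers, this cell).
[cite: GreenbergLNM1716, §3 Lemma 3.5 (p. 90) with Lemma 3.4 (p. 89)] -/
theorem Greenberg1999_kerG_bounded_two (W : WeierstrassCurve ℚ) [W.IsGloballyMinimal] (κ : ZpExtension ℚ 2) :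
    W.Greenberg1999_kerG_bounded κ := by
  refine W.Greenberg1999_kerG_bounded_of_atP_layerBounds κ fun hκ hp v hpv ↦ ?_
  obtain ⟨hgood, hunit⟩ := hp v hpv
  have hgo : GoodOrd W 2 :=
    ⟨W.hasGoodReductionAtPrime_of_hasGoodReductionAt v hpv hgood,
      (W.hasUnitRootAt_iff_not_dvd_frobeniusTrace v Fact.out hpv).mp hunit⟩
  exact exists_natCard_localTowerKerPrimary_at_two_le W hgo κ hκ v hpv

/-- **MAZUR'S CONTROL THEOREM over `ℚ` at `p = 2`** (Greenberg, LNM 1716, Thm. 1.2; Mazur 1972): for every globally minimal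
`W/ℚ` and every `κ : ZpExtension ℚ 2` the named predicate `W.selmer_control κ` holds — i.e. if `W` is elliptic with good
ordinary reduction at `2` and `κ` is the cyclotomic `ℤ₂`-extension, the natural maps
`Sel_{2^∞}(E/ℚ_n) → Sel_{2^∞}(E/ℚ_∞)^{Gal(ℚ_∞/ℚ_n)}` have finite kernels and cokernels of orders bounded independently
of `n`. Proof: Lemmas 3.1/3.2 (`selmer_control_of_kerG_bounded`, tree) and Lemma 3.5 at `2`
(`Greenberg1999_kerG_bounded_two`). [cite: GreenbergLNM1716, Thm 1.2 (pp. 59–60) and §3 (pp. 86–90)]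
[cite: MazurInvent1972, §6] -/
theorem selmer_control_two (W : WeierstrassCurve ℚ) [W.IsGloballyMinimal] (κ : ZpExtension ℚ 2) :
    W.selmer_control κ :=
  W.selmer_control_of_kerG_bounded κ (Greenberg1999_kerG_bounded_two W κ)

/-- **Greenberg's Theorem 1.4 at `p = 2` through the control chain** (for the record; the layer-`0` route
`SelmerDualData.isTorsion_of_finite_selmerGroup_rat` gives it at every `p`): for `W/ℚ` globally minimal, `κ : ZpExtension ℚ 2`
with topological generator `γ` and any dual datum `D` of `Sel_{2^∞}(E/ℚ_∞)`, the named fact `D.isTorsion_of_finite_selmerGroup`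
holds — good ordinary reduction at `2` and `Sel_{2^∞}(E/ℚ)` finite imply `X(E/ℚ_∞)` is `Λ`-torsion.
[cite: GreenbergLNM1716, Thm 1.4 (p. 60; proof p. 61)] -/
theorem isTorsion_of_finite_selmerGroup_two (W : WeierstrassCurve ℚ) [W.IsGloballyMinimal] (κ : ZpExtension ℚ 2)
    {γ : Field.absoluteGaloisGroup ℚ} (D : SelmerDualData W κ γ) : D.isTorsion_of_finite_selmerGroup :=
  D.isTorsion_of_finite_selmerGroup_of_kerG_bounded (Greenberg1999_kerG_bounded_two W κ)

end Summit.BirchSwinnertonDyer.BirchSwinnertonDyer.Theorems.GoodOrdTower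

end
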